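import Literature.NumberTheory.LFunctions.WeilExplicit
import Literature.NumberTheory.LFunctions.WeilMellinBounds
import Literature.NumberTheory.LFunctions.WeilArchimedeanMoments
import Literature.NumberTheory.LFunctions.WeilWindowSimpleEven

/-!
# Effective Theorem A for a general shape — toolkit and arithmetic
(crux `WeilComb.CombShapePositivity`, item stmt-RiemannHypothesis-11229, line `Sketch`; auxiliary file of
`WeilCombCombSubcriticalEffective.lean`, which proves `WeilComb.CombSubcritical` with the EXPLICIT universal constant
`c₀ = 1/128` for every Weil test `φ` supported in `[-1, 1]`)

* public general-`φ` toolkit: the dilation `φ_ε(t) = ε⁻¹ φ(t/ε)` (Weil test, `tsupport ⊆ [-ε, ε]`, `‖φ_ε‖₂² = ε⁻¹‖φ‖₂²`,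
  `‖φ_ε‖₁ = ‖φ‖₁`), finite sums of Weil tests, linearity of `W_∞ = weilArchTerm` over them, and the Diophantine gap
  `log p − log q ≥ 1/(q+1)`;
* `assemble_gen`: the pure real-arithmetic budget of the window `εM ≤ 1/128` with the pole bounded by `5N·A_m A_p`
  (`WeilCombSubcritical.stub_polar`): `log 128 − 5/2 − 1 − 0.91 ≥ 0.44 > 0`.
-/

noncomputable section

set_option linter.dupNamespace false

open scoped BigOperators ComplexConjugate
open Complex MeasureTheory Set

namespace Summit.RiemannHypothesis.RiemannHypothesis.Theorems.WeilCombBohrFejer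

open Literature.NumberTheory.LFunctions

/-- `φ_ε` is a Weil test function (`ε ≠ 0`). [folklore] -/
theorem isWeilTest_dil {φ : ℝ → ℂ} {ε : ℝ} (hφ : IsWeilTest φ) (hε : ε ≠ 0) :
    IsWeilTest (fun t : ℝ => (ε : ℂ)⁻¹ * φ (t / ε)) := by
  -- adapted from `WeilCombSubcritical.isWeilTest_dil_arch`
  have h1 : IsWeilTest (fun t : ℝ => φ (t / ε)) := by
    refine ⟨hφ.1.comp (contDiff_id.div_const ε), ?_⟩
    have e : (fun t : ℝ => φ (t / ε)) = φ ∘ (Homeomorph.mulRight₀ ε⁻¹ (inv_ne_zero hε)) := by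
      ext t
      simp [div_eq_mul_inv]
    rw [e]
    exact hφ.2.comp_homeomorph _
  exact h1.const_mul _

/-- `tsupport φ ⊆ [-1, 1]` gives `tsupport φ_ε ⊆ [-ε, ε]` (`ε > 0`). [folklore] -/
theorem tsupport_dil_subset {φ : ℝ → ℂ} {ε : ℝ} (hsupp : tsupport φ ⊆ Icc (-1) 1)
    (hε : 0 < ε) : tsupport (fun t : ℝ => (ε : ℂ)⁻¹ * φ (t / ε)) ⊆ Icc (-ε) ε := by
  -- adapted from `WeilCombSubcritical.tsupport_dil_subset_arch`
  refine closure_minimal ?_ isClosed_Icc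
  intro t ht
  rw [Function.mem_support] at ht
  have hφ : φ (t / ε) ≠ 0 := fun h => ht (by simp [h])
  have hmem : t / ε ∈ Icc (-1 : ℝ) 1 := hsupp (subset_tsupport _ hφ)
  constructor
  · have h := hmem.1
    rw [le_div_iff₀ hε] at h
    linarith
  · have h := hmem.2
    rw [div_le_iff₀ hε] at h
    linarith

/-- `‖φ_ε‖₂² = ε⁻¹ ‖φ‖₂²` (`ε > 0`). [folklore] -/
theorem weilNorm2Sq_dil (φ : ℝ → ℂ) {ε : ℝ} (hε : 0 < ε) :
    weilNorm2Sq (fun t : ℝ => (ε : ℂ)⁻¹ * φ (t / ε)) = ε⁻¹ * weilNorm2Sq φ := by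
  -- adapted from `WeilCombSubcritical.weilNorm2Sq_dil_arch`
  unfold weilNorm2Sq
  have e : (fun t : ℝ => ‖(ε : ℂ)⁻¹ * φ (t / ε)‖ ^ 2) = fun t => (ε⁻¹) ^ 2 * ‖φ (t / ε)‖ ^ 2 := by
    funext t
    rw [norm_mul, norm_inv, Complex.norm_real, Real.norm_eq_abs, abs_of_pos hε, mul_pow]
  rw [e, integral_const_mul, Measure.integral_comp_div (fun t => ‖φ t‖ ^ 2) ε, abs_of_pos hε,
    smul_eq_mul]
  field_simp

/-- `‖φ_ε‖₁ = ‖φ‖₁` (`ε > 0`). [folklore] -/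
theorem weilNorm1_dil (φ : ℝ → ℂ) {ε : ℝ} (hε : 0 < ε) :
    weilNorm1 (fun t : ℝ => (ε : ℂ)⁻¹ * φ (t / ε)) = weilNorm1 φ := by
  unfold weilNorm1
  have e : (fun t : ℝ => ‖(ε : ℂ)⁻¹ * φ (t / ε)‖) = fun t => ε⁻¹ * ‖φ (t / ε)‖ := by
    funext t
    rw [norm_mul, norm_inv, Complex.norm_real, Real.norm_eq_abs, abs_of_pos hε]
  rw [e, integral_const_mul, Measure.integral_comp_div (fun t => ‖φ t‖) ε, abs_of_pos hε,
    smul_eq_mul]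
  field_simp

/-- `W_∞(c · k) = c · W_∞(k)` (no hypotheses). [folklore] -/
theorem weilArchTerm_const_mul (c : ℂ) (k : ℝ → ℂ) :
    weilArchTerm (fun t => c * k t) = c * weilArchTerm k := by
  -- adapted from `WeilCombSubcritical.weilArchTerm_const_mul_arch`
  have hAI : weilArchIntegral (fun t => c * k t) = c * weilArchIntegral k := by
    simp only [weilArchIntegral, weilMellin_const_mul]
    rw [← integral_const_mul]
    congr 1 with t
    ring
  simp only [weilArchTerm, hAI]
  ring

/-- Finite sums of Weil tests are Weil tests. [folklore] -/
theorem isWeilTest_finset_sum {ι : Type*} (s : Finset ι) (F : ι → ℝ → ℂ)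
    (hF : ∀ i ∈ s, IsWeilTest (F i)) : IsWeilTest (fun t => ∑ i ∈ s, F i t) := by
  -- adapted from `WeilCombSubcritical.isWeilTest_finset_sum_arch`
  classical
  induction s using Finset.induction_on with
  | empty =>
    simp only [Finset.sum_empty]
    exact ⟨contDiff_const, HasCompactSupport.zero⟩
  | insert a s ha ih =>
    have hF' : ∀ i ∈ s, IsWeilTest (F i) := fun i hi => hF i (Finset.mem_insert_of_mem hi)
    have e : (fun t => ∑ i ∈ insert a s, F i t) = F a + fun t => ∑ i ∈ s, F i t := by
      funext t
      simp [Finset.sum_insert ha]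
    rw [e]
    exact (hF a (Finset.mem_insert_self a s)).add (ih hF')

/-- `W_∞(k₁ + k₂) = W_∞(k₁) + W_∞(k₂)` for Weil tests. [folklore] -/
theorem weilArchTerm_add {k₁ k₂ : ℝ → ℂ} (hk₁ : IsWeilTest k₁) (hk₂ : IsWeilTest k₂) :
    weilArchTerm (k₁ + k₂) = weilArchTerm k₁ + weilArchTerm k₂ := by
  -- adapted from `WeilCombSubcritical.weilArchTerm_add_arch`
  simp only [weilArchTerm, weilArchIntegral_add hk₁ hk₂, Pi.add_apply]
  ring

/-- `W_∞(Σ_{i ∈ s} F_i) = Σ_{i ∈ s} W_∞(F_i)` for Weil tests `F_i`. [folklore] -/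
theorem weilArchTerm_finset_sum {ι : Type*} (s : Finset ι) (F : ι → ℝ → ℂ)
    (hF : ∀ i ∈ s, IsWeilTest (F i)) :
    weilArchTerm (fun t => ∑ i ∈ s, F i t) = ∑ i ∈ s, weilArchTerm (F i) := by
  -- adapted from `WeilCombSubcritical.weilArchTerm_finset_sum_arch`
  classical
  induction s using Finset.induction_on with
  | empty =>
    simp only [Finset.sum_empty]
    have h := weilArchTerm_const_mul 0 (fun _ : ℝ => (0 : ℂ))
    simp only [zero_mul] at h
    exact h
  | insert a s ha ih =>
    have hF' : ∀ i ∈ s, IsWeilTest (F i) := fun i hi => hF i (Finset.mem_insert_of_mem hi)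
    have e : (fun t => ∑ i ∈ insert a s, F i t) = F a + fun t => ∑ i ∈ s, F i t := by
      funext t
      simp [Finset.sum_insert ha]
    rw [e, weilArchTerm_add (hF a (Finset.mem_insert_self a s))
      (isWeilTest_finset_sum s F hF'), ih hF', Finset.sum_insert ha]


/-- The Diophantine gap between logarithms of distinct positive integers `q < p`: `log p − log q ≥ 1/(q+1)`. [folklore] -/
theorem log_sub_log_ge_inv : ∀ {p q : ℕ}, 1 ≤ q → q < p →
    1 / ((q : ℝ) + 1) ≤ Real.log p - Real.log q := by
  intro p q hq hpq
  have hq0 : (0 : ℝ) < q := by exact_mod_cast hq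
  have hp0 : (0 : ℝ) < p := by exact_mod_cast (lt_of_lt_of_le hq hpq.le)
  have hqp : (q : ℝ) + 1 ≤ p := by exact_mod_cast hpq
  rw [← Real.log_div hp0.ne' hq0.ne']
  have h1 : ((q : ℝ) + 1) / q ≤ (p : ℝ) / q := div_le_div_of_nonneg_right hqp hq0.le
  have h2 : Real.log (((q : ℝ) + 1) / q) ≤ Real.log ((p : ℝ) / q) :=
    Real.log_le_log (by positivity) h1
  refine le_trans ?_ h2
  -- `1/(q+1) ≤ log(1 + 1/q)` from `1 - 1/x ≤ log x` at `x = (q+1)/q`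
  have h3 := Real.one_sub_inv_le_log_of_pos (x := ((q : ℝ) + 1) / q) (by positivity)
  have e : 1 - (((q : ℝ) + 1) / q)⁻¹ = 1 / ((q : ℝ) + 1) := by
    field_simp
    ring
  linarith [h3, e.symm.le, e.le]

/-- Pure real-arithmetic assembly of the effective window for a GENERAL admissible shape (pole bound with the
constant `5` of `WeilCombSubcritical.stub_polar`): the budget `log 128 − 5/2 − 1 − (pole + log-Hilbert + tail constants) ≥ 0.44 > 0`.
[folklore] -/
theorem assemble_gen {ε Mr N I L D Qp B S Am Ap V H ReQ ReP Wd Off : ℝ}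
    (hε : 0 < ε) (hM : 1 ≤ Mr) (hlam : ε * Mr ≤ 1 / 128)
    (hN : 0 ≤ N) (hI2 : I ^ 2 ≤ 2 * N)
    (hL : 0 ≤ L) (hD : 0 ≤ D) (hQp : 0 ≤ Qp) (hB : 0 ≤ B) (hS : S ^ 2 ≤ Mr * L)
    (hAm : 0 ≤ Am) (hAp : 0 ≤ Ap)
    (hA2 : (Am * Ap) ^ 2 ≤ 4 * Mr * L * (Mr * L + Qp))
    (hPoinc : Qp ≤ 2 * Mr * D + 2 * (Real.log 4 + 4) * Mr * L)
    (hBle : B ≤ 3 * Mr * L + 2 * Qp) (hV : V ≤ (Real.log Mr + 1) * L)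
    (hH : H = V - D)
    (hQ : ReQ = ReP - ε⁻¹ * N * H + (L * Wd + Off))
    (hP : -(5 * N * (Am * Ap)) ≤ ReP)
    (hWd : ε⁻¹ * N * (Real.log (1 / ε) - 5 / 2) - N * (9 + 3 * Real.log (1 / ε)) ≤ Wd)
    (hOff : -(I ^ 2 * (B + S ^ 2)) ≤ Off) :
    0 ≤ ReQ := by
  -- elementary constants
  have hl2 := Real.log_two_gt_d9
  have hl2' := Real.log_two_lt_d9
  have hlog4 : Real.log 4 = 2 * Real.log 2 := by
    rw [show (4 : ℝ) = 2 ^ 2 by norm_num, Real.log_pow]; norm_num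
  have hlog128 : Real.log 128 = 7 * Real.log 2 := by
    rw [show (128 : ℝ) = 2 ^ 7 by norm_num, Real.log_pow]; norm_num
  set c : ℝ := 2 * (Real.log 4 + 4) with hc
  have hcle : c ≤ 10.78 := by rw [hc, hlog4]; linarith
  have hc0 : 0 ≤ c := by rw [hc, hlog4]; linarith
  have hM0 : 0 < Mr := by linarith
  have hε128 : ε ≤ 1 / 128 := by
    have : ε * 1 ≤ ε * Mr := mul_le_mul_of_nonneg_left hM hε.le
    linarith
  -- `log(1/ε) ≥ log Mr + log 128`
  have hlogε : Real.log Mr + Real.log 128 ≤ Real.log (1 / ε) := by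
    have h1 : Real.log Mr + Real.log 128 = Real.log (128 * Mr) := by
      rw [Real.log_mul (by norm_num) hM0.ne']; ring
    rw [h1]
    apply Real.log_le_log (by positivity)
    rw [le_div_iff₀ hε]
    calc 128 * Mr * ε = 128 * (ε * Mr) := by ring
      _ ≤ 128 * (1 / 128) := by linarith
      _ = 1 := by norm_num
  -- `ε log(1/ε) ≤ (1/128) log 128 + 1/128`
  have hεlog : ε * Real.log (1 / ε) ≤ 1 / 128 * Real.log 128 + 1 / 128 := by
    have h1 : Real.log (1 / ε) = Real.log 128 + Real.log (1 / (128 * ε)) := by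
      rw [← Real.log_mul (by norm_num) (by positivity)]
      congr 1
      field_simp
    have h2 : Real.log (1 / (128 * ε)) ≤ 1 / (128 * ε) - 1 := Real.log_le_sub_one_of_pos (by positivity)
    have h3 : ε * Real.log (1 / (128 * ε)) ≤ ε * (1 / (128 * ε) - 1) :=
      mul_le_mul_of_nonneg_left h2 hε.le
    have h4 : ε * (1 / (128 * ε) - 1) = 1 / 128 - ε := by field_simp
    have h5 : ε * Real.log 128 ≤ 1 / 128 * Real.log 128 :=
      mul_le_mul_of_nonneg_right hε128 (by rw [hlog128]; linarith)
    rw [h1, mul_add]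
    linarith
  -- `ε Q' ≤ (2/128) D + (c/128) L`
  have hεQ : ε * Qp ≤ 2 / 128 * D + c / 128 * L := by
    have h1 : ε * Qp ≤ ε * (2 * Mr * D + c * Mr * L) := by
      apply mul_le_mul_of_nonneg_left _ hε.le
      rw [hc]; linarith
    have h2 : ε * (2 * Mr * D + c * Mr * L) = (ε * Mr) * (2 * D + c * L) := by ring
    have h3 : (ε * Mr) * (2 * D + c * L) ≤ (1 / 128) * (2 * D + c * L) :=
      mul_le_mul_of_nonneg_right hlam (by positivity)
    rw [h2] at h1
    linarith
  -- `ε A_m A_p ≤ 0.06 L + 0.01 D`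
  have hεAA : ε * (Am * Ap) ≤ 0.06 * L + 0.01 * D := by
    have h0 : 0 ≤ ε * (Am * Ap) := by positivity
    have h0' : 0 ≤ 0.06 * L + 0.01 * D := by positivity
    rw [← pow_le_pow_iff_left₀ h0 h0' two_ne_zero]
    have h1 : (ε * (Am * Ap)) ^ 2 ≤ ε ^ 2 * (4 * Mr * L * (Mr * L + Qp)) := by
      rw [mul_pow]; exact mul_le_mul_of_nonneg_left hA2 (sq_nonneg _)
    have h2 : ε ^ 2 * (4 * Mr * L * (Mr * L + Qp)) = 4 * ((ε * Mr) * L) * ((ε * Mr) * L + ε * Qp) := by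
      ring
    have hεML : (ε * Mr) * L ≤ 1 / 128 * L := mul_le_mul_of_nonneg_right hlam hL
    have hin0 : 0 ≤ (ε * Mr) * L + ε * Qp := by positivity
    have h3 : 4 * ((ε * Mr) * L) * ((ε * Mr) * L + ε * Qp) ≤
        4 * (1 / 128 * L) * (1 / 128 * L + (2 / 128 * D + c / 128 * L)) :=
      mul_le_mul (by linarith) (by linarith) hin0 (by positivity)
    have h4 : 4 * (1 / 128 * L) * (1 / 128 * L + (2 / 128 * D + c / 128 * L)) ≤
        (0.06 * L + 0.01 * D) ^ 2 := by
      have hLL : 0 ≤ L * L := mul_nonneg hL hL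
      have hLD : 0 ≤ L * D := mul_nonneg hL hD
      have hDD : 0 ≤ D * D := mul_nonneg hD hD
      have hcLL : c * (L * L) ≤ 10.78 * (L * L) := mul_le_mul_of_nonneg_right hcle hLL
      have e1 : 4 * (1 / 128 * L) * (1 / 128 * L + (2 / 128 * D + c / 128 * L)) =
          4 / 16384 * (L * L) + 8 / 16384 * (L * D) + 4 / 16384 * (c * (L * L)) := by ring
      have e2 : (0.06 * L + 0.01 * D) ^ 2 =
          0.0036 * (L * L) + 0.0012 * (L * D) + 0.0001 * (D * D) := by ring
      rw [e1, e2]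
      linarith
    rw [h2] at h1
    exact h1.trans (h3.trans h4)
  -- the log-Hilbert form and the ℓ¹ tail
  have hεML : (ε * Mr) * L ≤ 1 / 128 * L := mul_le_mul_of_nonneg_right hlam hL
  have hεB : 2 * ε * B ≤ 6 / 128 * L + 4 * (2 / 128 * D + c / 128 * L) := by
    have h1 : ε * B ≤ ε * (3 * Mr * L + 2 * Qp) := mul_le_mul_of_nonneg_left hBle hε.le
    have h2 : ε * (3 * Mr * L + 2 * Qp) = 3 * ((ε * Mr) * L) + 2 * (ε * Qp) := by ring
    rw [h2] at h1
    linarith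
  have hεS : 2 * ε * S ^ 2 ≤ 2 / 128 * L := by
    have h1 : ε * S ^ 2 ≤ ε * (Mr * L) := mul_le_mul_of_nonneg_left hS hε.le
    have h2 : ε * (Mr * L) = (ε * Mr) * L := by ring
    linarith
  have hεL : ε * L ≤ 1 / 128 * L := mul_le_mul_of_nonneg_right hε128 hL
  have h128lo : 4.852 ≤ Real.log 128 := by rw [hlog128]; linarith
  have h128hi : Real.log 128 ≤ 4.8521 := by rw [hlog128]; linarith
  have hεlog' : ε * Real.log (1 / ε) ≤ 4.8521 / 128 + 1 / 128 := by linarith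
  have hlogε' : Real.log Mr + 4.852 ≤ Real.log (1 / ε) := by linarith
  have hεlogL : (ε * Real.log (1 / ε)) * L ≤ (4.8521 / 128 + 1 / 128) * L :=
    mul_le_mul_of_nonneg_right hεlog' hL
  have hlogL : (Real.log Mr + 4.852) * L ≤ Real.log (1 / ε) * L :=
    mul_le_mul_of_nonneg_right hlogε' hL
  have hcL : c * L ≤ 10.78 * L := mul_le_mul_of_nonneg_right hcle hL
  -- the ε-rescaled bracket is nonnegative (the budget)
  have hX : 0 ≤ -5 * (ε * (Am * Ap)) - V + D + (Real.log (1 / ε) - 5 / 2) * L -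
      (9 * (ε * L) + 3 * ((ε * Real.log (1 / ε)) * L)) - 2 * ε * B - 2 * ε * S ^ 2 := by
    linarith
  -- `ReQ ≥ (N/ε) · bracket`
  have hWdL : L * (ε⁻¹ * N * (Real.log (1 / ε) - 5 / 2) - N * (9 + 3 * Real.log (1 / ε))) ≤ L * Wd :=
    mul_le_mul_of_nonneg_left hWd hL
  have hOff' : -(2 * N * (B + S ^ 2)) ≤ Off := by
    have hBS : 0 ≤ B + S ^ 2 := by positivity
    have := mul_le_mul_of_nonneg_right hI2 hBS
    linarith
  have hR : -5 * N * (Am * Ap) - ε⁻¹ * N * V + ε⁻¹ * N * D +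
      L * (ε⁻¹ * N * (Real.log (1 / ε) - 5 / 2) - N * (9 + 3 * Real.log (1 / ε))) -
        2 * N * (B + S ^ 2) ≤ ReQ := by
    rw [hH] at hQ
    linarith
  have e : ε⁻¹ * N * (-5 * (ε * (Am * Ap)) - V + D + (Real.log (1 / ε) - 5 / 2) * L -
      (9 * (ε * L) + 3 * ((ε * Real.log (1 / ε)) * L)) - 2 * ε * B - 2 * ε * S ^ 2) =
      -5 * N * (Am * Ap) - ε⁻¹ * N * V + ε⁻¹ * N * D +
      L * (ε⁻¹ * N * (Real.log (1 / ε) - 5 / 2) - N * (9 + 3 * Real.log (1 / ε))) -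
        2 * N * (B + S ^ 2) := by
    field_simp
    ring
  have hNε : 0 ≤ ε⁻¹ * N := mul_nonneg (inv_nonneg.2 hε.le) hN
  have := mul_nonneg hNε hX
  rw [e] at this
  linarith

end Summit.RiemannHypothesis.RiemannHypothesis.Theorems.WeilCombBohrFejer

end
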